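import Summits.CriticalPhenomena.PercolationContinuityZ3.Theorems.PercNearOneGluingNoHeavyLowerTailDualBHKDefs
import HarnessLib

/-!
# Dual BHK inequality — graph lemmas: glued classes and the peeling of one vertex

Support file 1/7 for the formalisation of the **dual BHK inequality** `u_b·u_c ≥ t·n′_a`
(`P(ab|c)·P(ac|b) ≥ P(abc)·P(a|b|c ∧ C_a separates b from c)`) on every finite weighted graph,
proved in the memo `run/shared/lean/prim/prim-ineq-gen-2/DUAL-BHK.md` §8 (prover prim-ineq-gen-2, gen 6;
`--supports stmt-CriticalPhenomena-4575`).  The proof is an Ahlswede–Daykin vertex-peeling induction in the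
style of van den Berg–Häggström–Kahn (2006), Thm. 1.1, for two families (`EA`, `MASTER`) of inequalities
between events of the *glued* open cluster of a root `a`.

This file is pure graph theory.  For a vertex universe `U : Finset V`, an open edge set `O` and "hubs"
`A, B : Set V` (vertex sets that are glued into one class) the *structure graph* is
`sG U O A B := og U O ⊔ gl A ⊔ gl B` (open edges with both ends in `U`, plus the cliques on `A` and on `B`).
We prove the two **peeling lemmas** describing reachability from `a` in `sG U …` in terms of `sG (U.erase v) …`
and the set `K = {d ∈ U ∖ v | vd ∈ O}` of open neighbours of the peeled vertex `v`:
* `v` in the hub `A` (`reach_peelHub_iff`, `reach_peelHub_v_iff`): replace `A` by `A^K := (A ∖ {v}) ∪ K`;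
* `v` in no hub (`reach_peelAvoid`): `a ↛ v` iff the class of `a` in `U ∖ v` misses `K`, and then the two
  classes coincide;
and the "unused glue" lemma `reach_of_sup_gl_of_forall_not` (a class that never meets `A` does not use the
glue on `A`).  [this work; pattern: VandenbergHaggstromKahn2005 §1 (conditioning on the neighbourhood)]
-/

namespace Summit.CriticalPhenomena.PercolationContinuityZ3.Theorems

namespace DualBHK

open SimpleGraph

variable {V : Type*}

/-! ### Monotonicity of the graphs -/

/-- The glue graph is monotone in the glued set. [this work] -/
theorem gl_mono {A B : Set V} (h : A ⊆ B) : gl A ≤ gl B := fun _ _ hxy => by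
  rw [gl_adj] at hxy ⊢
  exact ⟨hxy.1, h hxy.2.1, h hxy.2.2⟩

/-- Gluing the empty set does nothing. [this work] -/
@[simp] theorem gl_empty : gl (∅ : Set V) = ⊥ := by
  ext x y
  simp only [gl_adj, Set.mem_empty_iff_false, and_false, bot_adj]

/-- The open graph is monotone in the universe. [this work] -/
theorem og_mono_univ {U U' : Finset V} (h : U' ⊆ U) (O : Finset (Sym2 V)) : og U' O ≤ og U O := by
  intro x y hxy
  rw [og_adj] at hxy ⊢
  exact ⟨hxy.1, h hxy.2.1, h hxy.2.2.1, hxy.2.2.2⟩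

/-- The open graph is monotone in the open edge set. [this work] -/
theorem og_mono_edges (U : Finset V) {O O' : Finset (Sym2 V)} (h : O ⊆ O') : og U O ≤ og U O' := by
  intro x y hxy
  rw [og_adj] at hxy ⊢
  exact ⟨h hxy.1, hxy.2⟩

/-- The structure graph is monotone in the universe. [this work] -/
theorem sG_mono_univ {U U' : Finset V} (h : U' ⊆ U) (O : Finset (Sym2 V)) (A B : Set V) :
    sG U' O A B ≤ sG U O A B :=
  sup_le_sup (sup_le_sup (og_mono_univ h O) le_rfl) le_rfl

/-- The structure graph is monotone in the first hub. [this work] -/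
theorem sG_mono_left (U : Finset V) (O : Finset (Sym2 V)) {A A' : Set V} (h : A ⊆ A') (B : Set V) :
    sG U O A B ≤ sG U O A' B :=
  sup_le_sup (sup_le_sup le_rfl (gl_mono h)) le_rfl

/-- The structure graph is monotone in the second hub. [this work] -/
theorem sG_mono_right (U : Finset V) (O : Finset (Sym2 V)) (A : Set V) {B B' : Set V} (h : B ⊆ B') :
    sG U O A B ≤ sG U O A B' :=
  sup_le_sup le_rfl (gl_mono h)

/-- The structure graph is monotone in the open edge set. [this work] -/
theorem sG_mono_edges (U : Finset V) {O O' : Finset (Sym2 V)} (h : O ⊆ O') (A B : Set V) :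
    sG U O A B ≤ sG U O' A B :=
  sup_le_sup (sup_le_sup (og_mono_edges U h) le_rfl) le_rfl

/-- The two hubs play symmetric roles. [this work] -/
theorem sG_comm (U : Finset V) (O : Finset (Sym2 V)) (A B : Set V) : sG U O A B = sG U O B A := by
  simp only [sG]; rw [sup_assoc, sup_comm (gl A), ← sup_assoc]

/-- **Unused glue.** In `G ⊔ gl A`, a vertex `x` whose `G`-class misses `A` has the same class as in `G`.
[this work] -/
theorem reach_of_sup_gl_of_forall_not {G : SimpleGraph V} {A : Set V} {x y : V}
    (h : (G ⊔ gl A).Reachable x y) (hA : ∀ m ∈ A, ¬ G.Reachable x m) : G.Reachable x y := by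
  obtain ⟨p⟩ := h
  induction p with
  | nil => exact Reachable.refl _
  | @cons u w z huw _ ih =>
    rw [sup_adj, gl_adj] at huw
    rcases huw with huw | ⟨_, hu, _⟩
    · exact huw.reachable.trans (ih fun m hm hwm => hA m hm (huw.reachable.trans hwm))
    · exact absurd (Reachable.refl _) (hA u hu)

/-- A vertex with no edges cannot be reached from a different vertex. [folklore] -/
theorem not_reachable_of_isolated {G : SimpleGraph V} {a v : V} (hav : a ≠ v) (hv : ∀ x, ¬ G.Adj x v) :
    ¬ G.Reachable a v := by
  rintro ⟨p⟩
  cases hp : p.reverse with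
  | nil => exact hav rfl
  | cons h _ => exact hv _ h.symm

/-! ### Peeling one vertex -/

section Peel

variable {U : Finset V} {O : Finset (Sym2 V)} {v : V}

/-- An open neighbour of `v` lies in `K`. [this work] -/
theorem mem_Kset_of_og_adj {x : V} (h : (og U O).Adj x v) : x ∈ Kset U O v := by
  rw [og_adj] at h
  exact ⟨h.2.1, h.2.2.2, Sym2.eq_swap ▸ h.1⟩

/-- A vertex of `K` is an open neighbour of `v` (if `v ∈ U`). [this work] -/
theorem og_adj_of_mem_Kset (hv : v ∈ U) {x : V} (h : x ∈ Kset U O v) : (og U O).Adj x v := by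
  rw [og_adj]
  exact ⟨Sym2.eq_swap ▸ h.2.2, h.1, hv, h.2.1⟩

variable [DecidableEq V]

/-- An open edge of `U` not at `v` is an open edge of `U.erase v`. [this work] -/
theorem og_erase_adj_of {x y : V} (h : (og U O).Adj x y) (hx : x ≠ v) (hy : y ≠ v) :
    (og (U.erase v) O).Adj x y := by
  rw [og_adj] at h ⊢
  exact ⟨h.1, Finset.mem_erase.2 ⟨hx, h.2.1⟩, Finset.mem_erase.2 ⟨hy, h.2.2.1⟩, h.2.2.2⟩

/-- **Peeling a hub vertex, easy direction.** With `A' = (A ∖ {v}) ∪ K`, every class of `sG (U ∖ v) O A' B` is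
contained in a class of `sG U O A B` (for `v ∈ A ∩ U`). [this work] -/
theorem reach_of_reach_peelHub (hv : v ∈ U) {A B : Set V} (hvA : v ∈ A) {x y : V}
    (h : (sG (U.erase v) O ((A \ {v}) ∪ Kset U O v) B).Reachable x y) : (sG U O A B).Reachable x y := by
  -- every vertex of `A'` is a `sG U`-neighbour of `v` (or equal to it, which does not happen)
  have hnb : ∀ z ∈ (A \ {v}) ∪ Kset U O v, (sG U O A B).Reachable z v := by
    rintro z (⟨hzA, hzv⟩ | hzK)
    · refine Adj.reachable (sG_adj.2 (Or.inr (Or.inl ⟨hzv, hzA, hvA⟩)))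
    · exact Adj.reachable (sG_adj.2 (Or.inl (og_adj_of_mem_Kset hv hzK)))
  obtain ⟨p⟩ := h
  induction p with
  | nil => exact Reachable.refl _
  | @cons u w z huw _ ih =>
    refine Reachable.trans ?_ ih
    rcases sG_adj.1 huw with h1 | h1 | h1
    · exact Adj.reachable (sG_adj.2 (Or.inl (og_mono_univ (Finset.erase_subset v U) O h1)))
    · exact (hnb u h1.2.1).trans (hnb w h1.2.2).symm
    · exact Adj.reachable (sG_adj.2 (Or.inr (Or.inr h1)))

/-- The walk invariant behind `reach_peelHub_iff`. [this work] -/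
private theorem peelHub_inv (hv : v ∈ U) {A B : Set V} (hvB : v ∉ B) {x y : V}
    (p : (sG U O A B).Walk x y) :
    (x ≠ v → y ≠ v → (sG (U.erase v) O ((A \ {v}) ∪ Kset U O v) B).Reachable x y) ∧
    (x ≠ v → y = v → ∃ k ∈ (A \ {v}) ∪ Kset U O v,
        (sG (U.erase v) O ((A \ {v}) ∪ Kset U O v) B).Reachable x k) ∧
    (x = v → y ≠ v → ∃ k ∈ (A \ {v}) ∪ Kset U O v,
        (sG (U.erase v) O ((A \ {v}) ∪ Kset U O v) B).Reachable k y) := by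
  set A' : Set V := (A \ {v}) ∪ Kset U O v with hA'
  induction p with
  | nil =>
    exact ⟨fun _ _ => Reachable.refl _, fun h1 h2 => absurd h2 h1, fun h1 h2 => absurd h1 h2⟩
  | @cons u w z huw p ih =>
    obtain ⟨ih1, ih2, ih3⟩ := ih
    -- a `sG U`-neighbour of `v` other than through `gl B` lies in `A'`
    have hnbr : ∀ {s : V}, (sG U O A B).Adj s v → s ∈ A' := by
      intro s hs
      rcases sG_adj.1 hs with h1 | h1 | h1
      · exact Or.inr (mem_Kset_of_og_adj h1)
      · exact Or.inl ⟨h1.2.1, h1.1⟩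
      · exact absurd h1.2.2 hvB
    -- an edge avoiding `v` is an edge of the peeled structure graph
    have hedge : u ≠ v → w ≠ v → (sG (U.erase v) O A' B).Adj u w := by
      intro hu hw
      rcases sG_adj.1 huw with h1 | h1 | h1
      · exact sG_adj.2 (Or.inl (og_erase_adj_of h1 hu hw))
      · exact sG_adj.2 (Or.inr (Or.inl ⟨h1.1, Or.inl ⟨h1.2.1, hu⟩, Or.inl ⟨h1.2.2, hw⟩⟩))
      · exact sG_adj.2 (Or.inr (Or.inr h1))
    by_cases hw : w = v
    · subst hw
      have hu : u ∈ A' := hnbr huw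
      have hune : u ≠ w := huw.ne
      refine ⟨fun _ hz => ?_, fun _ _ => ⟨u, hu, Reachable.refl _⟩, fun h => absurd h hune⟩
      obtain ⟨k, hk, hkz⟩ := ih3 rfl hz
      by_cases huk : u = k
      · subst huk; exact hkz
      · exact (Adj.reachable (sG_adj.2 (Or.inr (Or.inl ⟨huk, hu, hk⟩)))).trans hkz
    · by_cases hu : u = v
      · subst hu
        have hwA : w ∈ A' := hnbr huw.symm
        exact ⟨fun h => absurd rfl h, fun h => absurd rfl h, fun _ hz => ⟨w, hwA, ih1 hw hz⟩⟩
      · have hR : (sG (U.erase v) O A' B).Reachable u w := (hedge hu hw).reachable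
        refine ⟨fun _ hz => hR.trans (ih1 hw hz), fun _ hz => ?_, fun h => absurd h hu⟩
        obtain ⟨k, hk, hwk⟩ := ih2 hw hz
        exact ⟨k, hk, hR.trans hwk⟩

/-- **Peeling a hub vertex** (`v ∈ A ∩ U`, `v ∉ B`): for `y ≠ v`, `y` is in the class of `x ≠ v` in
`sG U O A B` iff it is in the class of `x` in `sG (U ∖ v) O A' B`, `A' = (A ∖ {v}) ∪ K`. [this work] -/
theorem reach_peelHub_iff (hv : v ∈ U) {A B : Set V} (hvA : v ∈ A) (hvB : v ∉ B) {x y : V} (hx : x ≠ v)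
    (hy : y ≠ v) :
    (sG U O A B).Reachable x y ↔ (sG (U.erase v) O ((A \ {v}) ∪ Kset U O v) B).Reachable x y := by
  refine ⟨fun ⟨p⟩ => (peelHub_inv hv hvB p).1 hx hy, reach_of_reach_peelHub hv hvA⟩

/-- **Peeling a hub vertex, the vertex itself**: `v` is in the class of `x ≠ v` in `sG U O A B` iff that class,
computed in `sG (U ∖ v) O A' B`, meets `A' = (A ∖ {v}) ∪ K`. [this work] -/
theorem reach_peelHub_v_iff (hv : v ∈ U) {A B : Set V} (hvA : v ∈ A) (hvB : v ∉ B) {x : V} (hx : x ≠ v) :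
    (sG U O A B).Reachable x v ↔
      ∃ k ∈ (A \ {v}) ∪ Kset U O v, (sG (U.erase v) O ((A \ {v}) ∪ Kset U O v) B).Reachable x k := by
  refine ⟨fun ⟨p⟩ => (peelHub_inv hv hvB p).2.1 hx rfl, fun ⟨k, hk, hxk⟩ => ?_⟩
  refine (reach_of_reach_peelHub hv hvA hxk).trans ?_
  rcases hk with ⟨hkA, hkv⟩ | hkK
  · exact Adj.reachable (sG_adj.2 (Or.inr (Or.inl ⟨hkv, hkA, hvA⟩)))
  · exact Adj.reachable (sG_adj.2 (Or.inl (og_adj_of_mem_Kset hv hkK)))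

/-- **Hitting the peeled hub**: the class of `x ≠ v` in `sG U O A B` meets `A` iff its class in
`sG (U ∖ v) O A' B` meets `A'`. [this work] -/
theorem hits_peelHub_iff (hv : v ∈ U) {A B : Set V} (hvA : v ∈ A) (hvB : v ∉ B) {x : V} (hx : x ≠ v) :
    (∃ m ∈ A, (sG U O A B).Reachable x m) ↔
      ∃ k ∈ (A \ {v}) ∪ Kset U O v, (sG (U.erase v) O ((A \ {v}) ∪ Kset U O v) B).Reachable x k := by
  constructor
  · rintro ⟨m, hmA, hxm⟩
    by_cases hmv : m = v
    · subst hmv; exact (reach_peelHub_v_iff hv hvA hvB hx).1 hxm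
    · exact ⟨m, Or.inl ⟨hmA, hmv⟩, (reach_peelHub_iff hv hvA hvB hx hmv).1 hxm⟩
  · rintro ⟨k, hk, hxk⟩
    rcases hk with ⟨hkA, hkv⟩ | hkK
    · exact ⟨k, hkA, (reach_peelHub_iff hv hvA hvB hx hkv).2 hxk⟩
    · exact ⟨v, hvA, (reach_peelHub_v_iff hv hvA hvB hx).2 ⟨k, Or.inr hkK, hxk⟩⟩

/-- **Peeling an unglued vertex** (`v ∉ A ∪ B`, `x ≠ v`): if the class of `x` in `sG (U ∖ v) O A B` misses `K`,
then `v` is not in the class of `x` in `sG U O A B` and the two classes coincide. [this work] -/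
theorem reach_peelAvoid {A B : Set V} (hvA : v ∉ A) (hvB : v ∉ B) {x : V} (hx : x ≠ v)
    (hK : ∀ k ∈ Kset U O v, ¬ (sG (U.erase v) O A B).Reachable x k) {y : V}
    (h : (sG U O A B).Reachable x y) : y ≠ v ∧ (sG (U.erase v) O A B).Reachable x y := by
  obtain ⟨p⟩ := h
  induction p with
  | nil => exact ⟨hx, Reachable.refl _⟩
  | @cons u w z huw p ih =>
    by_cases hw : w = v
    · subst hw
      rcases sG_adj.1 huw with h1 | h1 | h1
      · exact absurd (Reachable.refl _) (hK u (mem_Kset_of_og_adj h1))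
      · exact absurd h1.2.2 hvA
      · exact absurd h1.2.2 hvB
    · have hR : (sG (U.erase v) O A B).Reachable u w := by
        rcases sG_adj.1 huw with h1 | h1 | h1
        · exact Adj.reachable (sG_adj.2 (Or.inl (og_erase_adj_of h1 hx hw)))
        · exact Adj.reachable (sG_adj.2 (Or.inr (Or.inl h1)))
        · exact Adj.reachable (sG_adj.2 (Or.inr (Or.inr h1)))
      obtain ⟨hz, hwz⟩ := ih hw fun k hk hwk => hK k hk (hR.trans hwk)
      exact ⟨hz, hR.trans hwz⟩

/-- **Peeling an unglued vertex, iff form**: `v` is outside the class of `x` in `sG U O A B` iff the class of `x` in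
`sG (U ∖ v) O A B` misses `K` (`v ∈ U`, `v ∉ A ∪ B`, `x ≠ v`). [this work] -/
theorem not_reach_v_iff_peelAvoid (hv : v ∈ U) {A B : Set V} (hvA : v ∉ A) (hvB : v ∉ B) {x : V}
    (hx : x ≠ v) :
    ¬ (sG U O A B).Reachable x v ↔ ∀ k ∈ Kset U O v, ¬ (sG (U.erase v) O A B).Reachable x k := by
  constructor
  · intro h k hk hxk
    exact h (((hxk.mono (sG_mono_univ (Finset.erase_subset v U) O A B))).trans
      (Adj.reachable (sG_adj.2 (Or.inl (og_adj_of_mem_Kset hv hk)))))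
  · intro hK h
    exact (reach_peelAvoid hvA hvB hx hK h).1 rfl

/-- Under the hypothesis of `reach_peelAvoid` the classes of `x` in `U` and in `U ∖ v` coincide. [this work] -/
theorem reach_iff_peelAvoid {A B : Set V} (hvA : v ∉ A) (hvB : v ∉ B) {x : V} (hx : x ≠ v)
    (hK : ∀ k ∈ Kset U O v, ¬ (sG (U.erase v) O A B).Reachable x k) (y : V) :
    (sG U O A B).Reachable x y ↔ (sG (U.erase v) O A B).Reachable x y :=
  ⟨fun h => (reach_peelAvoid hvA hvB hx hK h).2,
    fun h => h.mono (sG_mono_univ (Finset.erase_subset v U) O A B)⟩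

end Peel

end DualBHK

end Summit.CriticalPhenomena.PercolationContinuityZ3.Theorems
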